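import Mathlib
import HarnessLib
import Summits.RiemannHypothesis.RiemannHypothesis.Theses.WeilParity
import Summits.RiemannHypothesis.RiemannHypothesis.Theorems.WeilParityEvenWinsArch
import Summits.RiemannHypothesis.RiemannHypothesis.Theorems.WeilParityEvenWinsBeyondArchSplit
import Summits.RiemannHypothesis.RiemannHypothesis.Theorems.WeilParityEvenWinsBeyondArchStubOnePrimeWindow

/-!
# Route WeilParity: the thesis `EvenSectorWins` on EVERY window up to the second prime (RH-free)

A milestone of crux #3 `EvenWinsBeyondArch` (stmt-RiemannHypothesis-15432), registered as a landable
sub-goal `evenSectorWins_upTo_logThreeHalf`: for every window `0 < a ≤ (log 3)/2`, every odd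
`L²`-normalised Weil test on `[-a, a]` is matched up to any `δ > 0` by an even one — i.e. the thesis X
of the route restricted to the windows in which at most the prime `2` is present.  Two ranges:
the archimedean windows `a ≤ (log 2)/2` (crux #4 `EvenWinsArch`, landed `evenWinsArch_proof`) and the
one-prime windows `(log 2)/2 < a ≤ (log 3)/2`, where the Connes–van Suijlekom clause
(`Theorems.stub_onePrimeWindowSimpleEven`, landed: the sister crux's certified cells) gives the STRICT order
`ε_ev(a) < ε_od(a)` (`EvenWinsBeyondArch.weilEvenGroundEnergy_lt_weilOddGroundEnergy_of_weilWindowSimpleEven`)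
and ORDER ⇒ MATCHING (`evenWinsAt_of_le`).  What remains of the thesis (and of crux #3) beyond
`(log 3)/2` is exactly the RH-bearing residue `NoParityCrossing` (item 18085).
-/

namespace Summit.RiemannHypothesis.RiemannHypothesis.Theorems.WeilParity

open Literature.NumberTheory.LFunctions

/-- **The even sector wins on every window `0 < a ≤ (log 3)/2`** (the route thesis `EvenSectorWins`
restricted to the archimedean and one-prime windows; RH-free). [cite: Bombieri2000Weil, §4 Thm. 5 (sector bottoms); certificate in-tree] -/
theorem evenSectorWins_upTo_logThreeHalf :
    ∀ a : ℝ, 0 < a → a ≤ Real.log 3 / 2 → ∀ o : ℝ → ℂ,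
      Literature.NumberTheory.LFunctions.IsWeilTest o → tsupport o ⊆ Set.Icc (-a) a →
      (∀ t, o (-t) = -o t) → ∫ t, ‖o t‖ ^ 2 = (1 : ℝ) → ∀ δ : ℝ, 0 < δ →
        ∃ e : ℝ → ℂ, Literature.NumberTheory.LFunctions.IsWeilTest e ∧ tsupport e ⊆ Set.Icc (-a) a ∧
          (∀ t, e (-t) = e t) ∧ ∫ t, ‖e t‖ ^ 2 = (1 : ℝ) ∧
          (Literature.NumberTheory.LFunctions.weilQuadratic e).re ≤
            (Literature.NumberTheory.LFunctions.weilQuadratic o).re + δ := by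
  intro a ha hle o ho hos hodd hon δ hδ
  rcases le_or_gt a (Real.log 2 / 2) with h2 | h2
  · exact evenWinsArch_proof a ha h2 o ho hos hodd hon δ hδ
  · exact evenWinsAt_of_le ha
      (EvenWinsBeyondArch.weilEvenGroundEnergy_lt_weilOddGroundEnergy_of_weilWindowSimpleEven ha
        (Summit.RiemannHypothesis.RiemannHypothesis.Theorems.stub_onePrimeWindowSimpleEven a h2 hle)).le o ho hos hodd hon δ hδ

/-- Ground-energy form: `ε_ev(a) ≤ ε_od(a)` for every `0 < a ≤ (log 3)/2` (strict on the one-prime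
windows). [folklore] -/
theorem weilEvenGroundEnergy_le_weilOddGroundEnergy_of_le_logThreeHalf {a : ℝ} (ha : 0 < a)
    (hle : a ≤ Real.log 3 / 2) : weilEvenGroundEnergy a ≤ weilOddGroundEnergy a := by
  rcases le_or_gt a (Real.log 2 / 2) with h2 | h2
  · exact evenOrder ha h2
  · exact (EvenWinsBeyondArch.weilEvenGroundEnergy_lt_weilOddGroundEnergy_of_weilWindowSimpleEven ha
      (Summit.RiemannHypothesis.RiemannHypothesis.Theorems.stub_onePrimeWindowSimpleEven a h2 hle)).le

end Summit.RiemannHypothesis.RiemannHypothesis.Theorems.WeilParity
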